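import Summits.BirchSwinnertonDyer.BirchSwinnertonDyer.Theorems.UniversalToricDescentRoadFFPerLevelDescentTwin
import HarnessLib

/-!
# Route `UniversalToricDescent`, ♭B column (♭B′ `TwinWanFrameAtThreeMultTresT` 27401), line `membertower`:
# the per-level one-sided congruence limit with an EXPLICIT DESCENT hypothesis in place of faithful flatness of the
# receptacle — so that the receptacle of the member data may be `𝓞_{ℂ_p}⟦T⟧` (descent supplied by p631025)

Cell `bsd-wall` (run/shared/lean/pub/bsd-wall/), seat `bsd-wall-utd-p2` (lead prover g13, 2026-08-28);
`--supports stmt-BirchSwinnertonDyer-27401 --as helper`; Theses-free, pure algebra on the tree objects.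

§1 `CongruenceDescent.map_span_mul_fittingIdeal_le_sup_of_congruence_le_of_desc` — p612782's twisted one congruence step
`(a·Fitt_{R'}(N))·S' ⊆ (L_m)`, `(L_m) ⊆ (L) + I^m S'` ⟹ `(a·Fitt_R(M))·S ⊆ (L) + I^m S`, VERBATIM except that the last line
(contraction along `S → S'` by FAITHFUL FLATNESS) is replaced by an explicit descent hypothesis `hdesc` for the ideal
`(L) + I^m S`. §2 `CongruenceDescent.map_le_span_of_oneSided_congruences_le_perLevel_of_desc` — p624148's per-level limit
(untwisting under avoidance, Krull) with the same replacement. §3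
`AcSelmer.XAc.map_fittingIdeal_le_span_of_oneSided_congruences_le_printed_perLevel_of_desc` — p625405 §1 (members in the
PRINTED shape «torsion → `(p^{e_m}·Ch)·S' ⊆ (L_m)`», twist `p^{e_m}`, UNTWISTED under `p`-avoidance of `L^Σ`) with the same
replacement. HONEST FRAMING: theorems only; unconditional algebra; nothing booked; BSD is proved for no curve.
References: [Skinner2016PacificMC] §3.1 (p. 192); [Castella2018Erratum] proof of Thm. 1.1 (p. 4); [StacksProject] 07ZA (3), 05GI.
-/

set_option autoImplicit false

noncomputable section

open scoped Classical TensorProduct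

open PowerSeries Literature.NumberTheory.EllipticCurves Literature.NumberTheory.EllipticCurves.Module
  Literature.RingTheory.FittingIdeal NumberField IsDedekindDomain Field
open Summit.BirchSwinnertonDyer.Rank1Residual.X11b.AcSelmer Summit.BirchSwinnertonDyer.Rank1Residual.X11b.Halves
  Summit.BirchSwinnertonDyer.Rank1Residual.X2

namespace Summit.BirchSwinnertonDyer.Rank1Residual.X11b

/-! ### §1 One twisted congruence step, descent hypothesis explicit -/

namespace CongruenceDescent

universe u v w

variable {R : Type*} [CommRing R] {S : Type u} [CommRing S] (φ : R →+* S) (I : Ideal R)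
  {M : Type*} [AddCommGroup M] [Module R M] [Module.Finite R M]

/-- **One congruence step with its own coefficients, (c) ONE-SIDED, member inclusion TWISTED by `a ∈ R`, DESCENT EXPLICIT.**
Square `R → R' →(φ') S' ← S`, `(R' ⊗_R M)/I^m ≅ N/I^m`, `(a·Fitt_{R'}(N))·S' ⊆ (L_m)`, `(L_m) ⊆ (L) + I^m S'`, and the
DESCENT hypothesis «every ideal `J' ⊆ S` with `J'·S' ⊆ ((L) + I^m S)·S'` lies in `(L) + I^m S`» (true when `S'` is
faithfully flat over `S`, p612782; and along `R₀⟦T⟧ → 𝓞_{ℂ_p}⟦T⟧` for `μ(L) = 0`, p631025). Then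
`(a·Fitt_R(M))·S ⊆ (L) + I^m S`. Proof = p612782's up to the contraction. [cite: StacksProject, Tag 07ZA (3)]
[cite: Castella2018Erratum, proof of Thm. 1.1 (p. 4), read one-sidedly] -/
theorem map_span_mul_fittingIdeal_le_sup_of_congruence_le_of_desc (a : R)
    (R' : Type v) [CommRing R'] [Algebra R R'] (S' : Type w) [CommRing S'] [Algebra S S'] (φ' : R' →+* S')
    (hφ' : φ'.comp (algebraMap R R') = (algebraMap S S').comp φ)
    (N : Type*) [AddCommGroup N] [Module R' N] [Module.Finite R' N] {L : S} {Lm : S'} {m : ℕ}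
    (e : ((R' ⊗[R] M) ⧸ ((I.map (algebraMap R R')) ^ m • (⊤ : Submodule R' (R' ⊗[R] M)))) ≃ₗ[R']
      (N ⧸ ((I.map (algebraMap R R')) ^ m • (⊤ : Submodule R' N))))
    (hF : (Ideal.span {algebraMap R R' a} * Module.fittingIdeal R' N 0).map φ' ≤ Ideal.span {Lm})
    (hc : Ideal.span {Lm} ≤
      Ideal.span {algebraMap S S' L} ⊔ ((I.map φ).map (algebraMap S S')) ^ m)
    (hdesc : ∀ J' : Ideal S, J'.map (algebraMap S S') ≤ (Ideal.span {L} ⊔ (I.map φ) ^ m).map (algebraMap S S') →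
      J' ≤ Ideal.span {L} ⊔ (I.map φ) ^ m) :
    (Ideal.span {a} * Module.fittingIdeal R M 0).map φ ≤ Ideal.span {L} ⊔ (I.map φ) ^ m := by
  set ψ : S →+* S' := algebraMap S S' with hψ
  have hcomp : ψ.comp φ = φ'.comp (algebraMap R R') := by rw [hψ, hφ']
  have ha : (Ideal.span {a}).map (algebraMap R R') = Ideal.span {algebraMap R R' a} := by
    rw [Ideal.map_span, Set.image_singleton]
  have hA : ((Ideal.span {a} * Module.fittingIdeal R M 0).map φ).map ψ =
      (Ideal.span {algebraMap R R' a} * Module.fittingIdeal R' (R' ⊗[R] M) 0).map φ' := by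
    rw [Ideal.map_map, hcomp, ← Ideal.map_map, Ideal.map_mul, ha, Module.fittingIdeal_baseChange]
  have hB : ((I.map φ) ^ m).map ψ = ((I.map (algebraMap R R')) ^ m).map φ' := by
    rw [Ideal.map_pow, Ideal.map_pow, Ideal.map_map, Ideal.map_map, hcomp]
  have hB' : ((I.map φ).map ψ) ^ m = ((I.map (algebraMap R R')) ^ m).map φ' := by
    rw [← Ideal.map_pow, hB]
  have hC : (Ideal.span {L}).map ψ = Ideal.span {ψ L} := by
    rw [Ideal.map_span, Set.image_singleton]
  have hstep : (Ideal.span {algebraMap R R' a} * Module.fittingIdeal R' (R' ⊗[R] M) 0).map φ' ≤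
      Ideal.span {Lm} ⊔ ((I.map (algebraMap R R')) ^ m).map φ' := by
    have h0 : Module.fittingIdeal R' (R' ⊗[R] M) 0 ≤
        Module.fittingIdeal R' N 0 ⊔ (I.map (algebraMap R R')) ^ m := by
      have := (le_sup_left : Module.fittingIdeal R' (R' ⊗[R] M) 0 ≤
        Module.fittingIdeal R' (R' ⊗[R] M) 0 ⊔ (I.map (algebraMap R R')) ^ m)
      rwa [CongruenceLimit.fittingIdeal_sup_eq_of_quotEquiv ((I.map (algebraMap R R')) ^ m) e 0] at this
    have h1 : Ideal.span {algebraMap R R' a} * Module.fittingIdeal R' (R' ⊗[R] M) 0 ≤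
        Ideal.span {algebraMap R R' a} * Module.fittingIdeal R' N 0 ⊔ (I.map (algebraMap R R')) ^ m :=
      (Ideal.mul_mono_right h0).trans (by
        rw [Ideal.mul_sup]
        exact sup_le_sup_left Ideal.mul_le_left _)
    refine (Ideal.map_mono h1).trans ?_
    rw [Ideal.map_sup]
    exact sup_le_sup_right hF _
  have himg : ((Ideal.span {a} * Module.fittingIdeal R M 0).map φ).map ψ ≤
      (Ideal.span {L} ⊔ (I.map φ) ^ m).map ψ := by
    rw [Ideal.map_sup, hA, hB, hC]
    refine hstep.trans (sup_le ?_ le_sup_right)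
    rw [← hB']
    exact hc
  exact hdesc _ himg

/-! ### §2 The per-level one-sided congruence limit, descent hypothesis explicit -/

/-- **The one-sided congruence limit with a PER-LEVEL twist, DESCENT EXPLICIT** — p624148's
`map_le_span_of_oneSided_congruences_descent_le_perLevel` with `[Module.FaithfullyFlat S (S' m)]` replaced by the per-level
descent hypothesis `hdesc m` for the ideal `(L) + (πR)^m S`. `S` Noetherian, `π := φ(πR) ∈ Jac(S)`, `L` avoids `π`,
`J ⊆ Fitt_R(M)`, exponents with `∀ n ∃ m ≥ 1, e_m + n ≤ m`; then `J·S ⊆ (L)`.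
[cite: Skinner2016PacificMC, §3.1 (p. 192)] [cite: StacksProject, Tag 05GI (Krull's intersection theorem)] -/
theorem map_le_span_of_oneSided_congruences_le_perLevel_of_desc [IsNoetherianRing S]
    (πR : R) (hI : (Ideal.span {πR}).map φ ≤ (⊥ : Ideal S).jacobson)
    {J : Ideal R} (hJ : J ≤ Module.fittingIdeal R M 0) (L : S)
    (hav : ∀ y : S, φ πR * y ∈ Ideal.span ({L} : Set S) → y ∈ Ideal.span ({L} : Set S))
    (e : ℕ → ℕ) (hunb : ∀ n : ℕ, ∃ m : ℕ, 1 ≤ m ∧ e m + n ≤ m)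
    (R' : ℕ → Type v) [∀ m, CommRing (R' m)] [∀ m, Algebra R (R' m)]
    (S' : ℕ → Type w) [∀ m, CommRing (S' m)] [∀ m, Algebra S (S' m)] (φ' : ∀ m, R' m →+* S' m)
    (hφ' : ∀ m, (φ' m).comp (algebraMap R (R' m)) = (algebraMap S (S' m)).comp φ)
    (N : ℕ → Type*) [∀ m, AddCommGroup (N m)] [∀ m, Module (R' m) (N m)]
    [∀ m, Module.Finite (R' m) (N m)] (Lm : ∀ m, S' m)
    (eqv : ∀ m : ℕ, 1 ≤ m →
      (((R' m ⊗[R] M) ⧸ (((Ideal.span {πR}).map (algebraMap R (R' m))) ^ m •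
          (⊤ : Submodule (R' m) (R' m ⊗[R] M)))) ≃ₗ[R' m]
        (N m ⧸ (((Ideal.span {πR}).map (algebraMap R (R' m))) ^ m • (⊤ : Submodule (R' m) (N m))))))
    (hF : ∀ m : ℕ, 1 ≤ m →
      (Ideal.span {algebraMap R (R' m) (πR ^ e m)} * Module.fittingIdeal (R' m) (N m) 0).map (φ' m) ≤
        Ideal.span {Lm m})
    (hc : ∀ m : ℕ, 1 ≤ m →
      Ideal.span {Lm m} ≤
        Ideal.span {algebraMap S (S' m) L} ⊔ (((Ideal.span {πR}).map φ).map (algebraMap S (S' m))) ^ m)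
    (hdesc : ∀ (m : ℕ) (J' : Ideal S),
      J'.map (algebraMap S (S' m)) ≤ (Ideal.span {L} ⊔ ((Ideal.span {πR}).map φ) ^ m).map (algebraMap S (S' m)) →
        J' ≤ Ideal.span {L} ⊔ ((Ideal.span {πR}).map φ) ^ m) :
    J.map φ ≤ Ideal.span {L} := by
  have hmapI : (Ideal.span {πR}).map φ = Ideal.span {φ πR} := by
    rw [Ideal.map_span, Set.image_singleton]
  refine (Ideal.map_mono hJ).trans ?_
  rw [← CongruenceLimit.iInf_sup_pow_eq_self ((Ideal.span {πR}).map φ) (Ideal.span {L}) hI]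
  refine le_iInf fun n ↦ ?_
  obtain ⟨m, hm, hmn⟩ := hunb n
  have step := map_span_mul_fittingIdeal_le_sup_of_congruence_le_of_desc φ (Ideal.span {πR}) (πR ^ e m)
    (R' m) (S' m) (φ' m) (hφ' m) (N m) (eqv m hm) (hF m hm) (hc m hm) (hdesc m)
  rw [Ideal.map_mul, Ideal.map_span, Set.image_singleton, map_pow, hmapI] at step
  have h2 := le_sup_span_pow_of_span_pow_mul_le hav (by omega : e m ≤ m) step
  rw [hmapI]
  exact h2.trans (sup_le_sup_left (Ideal.pow_le_pow_right (by omega : n ≤ m - e m)) _)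

end CongruenceDescent

/-! ### §3 On `X^Σ = X_ac^Σ(E[p^∞])`: the untwisted per-level member limit, descent hypothesis explicit -/

section XAc

variable {K : Type} [Field K] [NumberField K] (E : WeierstrassCurve K) [E.IsElliptic]
  (p : ℕ) [Fact p.Prime] (κ : ZpExtension K p) (𝔭 : HeightOneSpectrum (𝓞 K))
  {S : Set (HeightOneSpectrum (𝓞 K))} (γ : Field.absoluteGaloisGroup K) [Fact (κ.IsTopGenerator γ)]

universe v w

/-- **The member limit ON `X^Σ` at the Fitting level, PRINTED shape, per-level twist `p^{e_m}`, UNTWISTED, DESCENT EXPLICIT**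
— p625405's `AcSelmer.XAc.map_fittingIdeal_le_span_of_oneSided_congruences_descent_le_printed_perLevel` with the instance
`[Module.FaithfullyFlat (UnrSeries p) (S' m)]` replaced by the descent hypothesis `hdesc m` for the ideals
`(L^Σ) + (p^m)` of `R₀⟦T⟧`. THEN `Fitt₀_Λ(X^Σ)·R₀⟦T⟧ ⊆ (L^Σ)`.
[cite: Skinner2016PacificMC, §2.6, §3.1 (p. 192)] [cite: Castella2018Erratum, (2.5) and proof of Thm. 1.1 (p. 4), read one-sidedly] -/
theorem AcSelmer.XAc.map_fittingIdeal_le_span_of_oneSided_congruences_le_printed_perLevel_of_desc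
    (hS : S.Finite) (e : ℕ → ℕ) (hunb : ∀ n : ℕ, ∃ m : ℕ, 1 ≤ m ∧ e m + n ≤ m) (LS : UnrSeries p)
    (hav : ∀ y : UnrSeries p, (C ((p : ℕ) : unrIntegers p) : UnrSeries p) * y ∈ Ideal.span ({LS} : Set (UnrSeries p)) →
      y ∈ Ideal.span ({LS} : Set (UnrSeries p)))
    (R' : ℕ → Type v) [∀ m, CommRing (R' m)]
    [∀ m, IsNoetherianRing (R' m)] [∀ m, IsDomain (R' m)] [∀ m, UniqueFactorizationMonoid (R' m)]
    [∀ m, Algebra (IwasawaAlgebra p) (R' m)]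
    (S' : ℕ → Type w) [∀ m, CommRing (S' m)] [∀ m, Algebra (UnrSeries p) (S' m)] (φ' : ∀ m, R' m →+* S' m)
    (hφ' : ∀ m, (φ' m).comp (algebraMap (IwasawaAlgebra p) (R' m)) =
      (algebraMap (UnrSeries p) (S' m)).comp (PowerSeries.map (toUnr p)))
    (N : ℕ → Type) [∀ m, AddCommGroup (N m)] [∀ m, Module (R' m) (N m)]
    [∀ m, Module.Finite (R' m) (N m)] (Lm : ∀ m, S' m)
    (eqv : ∀ m : ℕ, 1 ≤ m →
      (((R' m ⊗[IwasawaAlgebra p] XAc E p κ 𝔭 S γ) ⧸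
          (((Ideal.span {(PowerSeries.C (p : ℤ_[p]) : IwasawaAlgebra p)}).map
              (algebraMap (IwasawaAlgebra p) (R' m))) ^ m •
            (⊤ : Submodule (R' m) (R' m ⊗[IwasawaAlgebra p] XAc E p κ 𝔭 S γ)))) ≃ₗ[R' m]
        (N m ⧸ (((Ideal.span {(PowerSeries.C (p : ℤ_[p]) : IwasawaAlgebra p)}).map
            (algebraMap (IwasawaAlgebra p) (R' m))) ^ m • (⊤ : Submodule (R' m) (N m))))))
    (hCh : ∀ m : ℕ, 1 ≤ m → Module.IsTorsion (R' m) (N m) →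
      Ideal.span {φ' m (algebraMap (IwasawaAlgebra p) (R' m) ((PowerSeries.C (p : ℤ_[p]) : IwasawaAlgebra p) ^ e m))} *
          (Module.charIdeal (R' m) (N m)).map (φ' m) ≤ Ideal.span {Lm m})
    (hc : ∀ m : ℕ, 1 ≤ m →
      Ideal.span {Lm m} ≤
        Ideal.span {algebraMap (UnrSeries p) (S' m) LS} ⊔
          (((Ideal.span {(PowerSeries.C (p : ℤ_[p]) : IwasawaAlgebra p)}).map
              (PowerSeries.map (toUnr p))).map (algebraMap (UnrSeries p) (S' m))) ^ m)
    (hdesc : ∀ (m : ℕ) (J' : Ideal (UnrSeries p)),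
      J'.map (algebraMap (UnrSeries p) (S' m)) ≤
          (Ideal.span {LS} ⊔ ((Ideal.span {(PowerSeries.C (p : ℤ_[p]) : IwasawaAlgebra p)}).map
            (PowerSeries.map (toUnr p))) ^ m).map (algebraMap (UnrSeries p) (S' m)) →
        J' ≤ Ideal.span {LS} ⊔ ((Ideal.span {(PowerSeries.C (p : ℤ_[p]) : IwasawaAlgebra p)}).map
          (PowerSeries.map (toUnr p))) ^ m) :
    (Module.fittingIdeal (IwasawaAlgebra p) (XAc E p κ 𝔭 S γ) 0).map (PowerSeries.map (toUnr p)) ≤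
      Ideal.span {LS} := by
  haveI : Module.Finite (IwasawaAlgebra p) (XAc E p κ 𝔭 S γ) := XAc.module_finite κ 𝔭 S γ hS
  haveI := HidaLimitAlgebra.isNoetherianRing_unrSeries (p := p)
  have hI : (Ideal.span {(PowerSeries.C (p : ℤ_[p]) : IwasawaAlgebra p)}).map
      (PowerSeries.map (toUnr p)) ≤ (⊥ : Ideal (UnrSeries p)).jacobson := by
    rw [HidaLimitAlgebra.map_span_C_p]
    exact HidaLimitAlgebra.span_C_p_le_jacobson_unrSeries
  have hφp : (PowerSeries.map (toUnr p)) (PowerSeries.C (p : ℤ_[p]) : IwasawaAlgebra p) =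
      (C ((p : ℕ) : unrIntegers p) : UnrSeries p) := by
    rw [PowerSeries.map_C, map_natCast]
  exact CongruenceDescent.map_le_span_of_oneSided_congruences_le_perLevel_of_desc
    (PowerSeries.map (toUnr p)) (PowerSeries.C (p : ℤ_[p]) : IwasawaAlgebra p) hI (le_refl _) LS
    (by rw [hφp]; exact hav) e hunb R' S' φ' hφ' N Lm eqv
    (fun m hm ↦ CongruenceDescent.map_span_mul_fittingIdeal_le_of_printed_charIdeal_le (φ' m)
      (algebraMap (IwasawaAlgebra p) (R' m) ((PowerSeries.C (p : ℤ_[p]) : IwasawaAlgebra p) ^ e m))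
      (fun hT ↦ by
        rw [Ideal.map_mul, Ideal.map_span, Set.image_singleton]
        exact hCh m hm hT)) hc hdesc

end XAc

end Summit.BirchSwinnertonDyer.Rank1Residual.X11b

end
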